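import Summits.Schanuel.Schanuel.Theses.RoyCriterion
import Summits.Schanuel.Schanuel.Theorems.RoyCriterionRankOne
import Literature.NumberTheory.Transcendental.RoyCriterionProp3Proofs
import Literature.NumberTheory.Transcendental.LindemannWeierstrassProofs
import HarnessLib

/-!
# Schanuel / RoyCriterion — Roy's criterion in rank one, full parameter window

Route `Schanuel/RoyCriterion`, item `stmt-Schanuel-0080` (support; route decl
`Summit.Schanuel.Schanuel.Theses.RoyCriterion.RoySmallValueGaGmRankOneFullWindow`, which unfolds to
`Literature.NumberTheory.Transcendental.RoyCriterion 1`): Roy's Conjecture 2 (Roy 2001, §1) in rank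
`l = 1`, for the FULL admissible window `max(1,t₀,2t₁) < min(s₀,2s₁)`, `max(s₀,s₁+t₁) < u < (1+t₀+t₁)/2`
(the window is built into `RoyCriterion` through `RoyAdmissible`).

Roy (Acta Arith. 97 (2001), p. 184) observes that Conjecture 2 holds for `l = 1`: by his Theorem 1 /
§5 the criterion in rank `l` is equivalent to Schanuel's conjecture in rank `l`, and rank one of
Schanuel's conjecture is the Hermite–Lindemann theorem. All three ingredients are theorems in the
tree:

* `Literature.NumberTheory.Transcendental.Roy2001_iff_holds` — `∀ l, RoyCriterion l ↔ SchanuelRank l`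
  (`RoyCriterionProp3Proofs.lean`, sorry-free);
* `Literature.NumberTheory.Transcendental.transcendental_exp_holds` — Hermite–Lindemann
  (`LindemannWeierstrassProofs.lean`, sorry-free);
* `Literature.Transcend.royCriterion_one_of_facts` — the rank-one packaging
  (`Summits/Schanuel/Schanuel/Theorems/RoyCriterionRankOne.lean`).

So the item closes UNCONDITIONALLY by one term. As the route docstring says, this settles the truth
value (known since 1882 + 2001), not the METHOD question whether small value estimates on 𝔾ₐ×𝔾ₘ reach
the exponent `(1+t₀+t₁)/2` directly (Roy 2013, Mathematika 59, Thm 1.1 covers a sub-window only); that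
method-level content is carried by the cruxes `RoySmallValueDirichletGap` / `NguyenRoySmallValueTranslates`.
-/

-- single-conjunct summit: `Summit.Schanuel.Schanuel.…` is the mandated namespace (CONVENTIONS §1)
set_option linter.dupNamespace false

namespace Summit.Schanuel.Schanuel.Theorems

/-- Settles `stmt-Schanuel-0080`: Roy's arithmetic criterion (Roy 2001, Conjecture 2) holds in rank
one on the full admissible window, i.e. `Literature.NumberTheory.Transcendental.RoyCriterion 1`.
Proof: Roy's equivalence `RoyCriterion 1 ↔ SchanuelRank 1` (Roy 2001, Thm 1 and §5; tree theorem
`Roy2001_iff_holds`) and Hermite–Lindemann (tree theorem `transcendental_exp_holds`), packaged by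
`Literature.Transcend.royCriterion_one_of_facts`. Unconditional. [cite: Roy2001, §1 p. 184] -/
theorem roySmallValueGaGmRankOneFullWindow_proof :
    Summit.Schanuel.Schanuel.Theses.RoyCriterion.RoySmallValueGaGmRankOneFullWindow := by
  unfold Summit.Schanuel.Schanuel.Theses.RoyCriterion.RoySmallValueGaGmRankOneFullWindow
  exact Literature.Transcend.royCriterion_one_of_facts
    Literature.NumberTheory.Transcendental.Roy2001_iff_holds
    Literature.NumberTheory.Transcendental.transcendental_exp_holds

end Summit.Schanuel.Schanuel.Theorems
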